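import Summits.QuantumFields.YangMills.Theorems.BalabanUVNodesN12FlatFibreNullSpaceDetSet
import Literature.MathematicalPhysics.QuantumFieldTheory.Balaban1983to89.Node00.MultiScaleFibreChartB
import Summits.QuantumFields.YangMills.Theorems.BalabanUVNodesN12FlatChartDerivIterLinB
import HarnessLib

/-!
# BalabanUVNodes ∕ N12 — (β)♭ FOR A GENERAL DETERMINING SET `𝐁 = {Γ_j}_{j ≤ k}` ([Balaban1988Convergent] (2.2)): THE NULL SPACE OF THE FLAT SECOND VARIATION ON THE JOINT LINEARISED FIBRE — **BOND-DATUM EDITION** (`…N12FlatFibreNullSpaceDetSetB`, USED DECLARATIONS ONLY)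

The print-datum ([Balaban1984PropagatorsII] (2.3)) (γ) twin of `Summits/…/Theorems/BalabanUVNodesN12FlatFibreNullSpaceDetSet.lean`: the declarations of the parent whose STATEMENT reads the determining datum
(`iterLin_eq_zero_of_fderiv_msChart_one_eq_zero_detSet`) and which N12's junction of record v14ᴸ uses (dag-n12-c g35 probe-2 census `UsedConstsN12RoadTyped2`, THEOREMS block), re-typed over a
BOND-LEVEL datum `𝔅 : BDetSet` (F0a `B15DeterminingSetsB`) and dag-n12-c's bond-datum chart `Node00.msChartB` (✓p774329; `msChart 𝐁 = msChartB (bondsDet 𝐁)` by `rfl`).  GENERATOR twin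
(this seat's `work/g32/gen_thm.py`, block-extracted from the parent's tree bytes): namespace `…N12FlatFibreNullSpaceDetSetB`, SAME short names, `DetSet ↦ BDetSet`, `AgreeOn 𝐁 ↦ AgreeOnB 𝔅`,
`IsMinimizer ↦ IsMinimizerB`, `bondsOf (𝐁 j) ↦ 𝔅 j`, `msChart ∕ constrCard ∕ constrEnum ∕ ConstrSet ↦ …B`, NODE 00 chart lemmas `…msChart… ↦ …msChartB…`; proofs VERBATIM; the parent's
datum-free declarations REUSED BY NAME (`open`), never copied (private plumbing excepted, №366 R2).  The parent's (b) statements are the instances `𝔅 := bondsDet 𝐁`.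

Cell `pub-ymgap` (HUMAN RULINGS D-0062 ∕ D-0149), seat `pub-ymgap-dag-n12-d` g32 (R134 N12 [B15] s2; the (ii) Theorems-side re-key of N12's road at print's [II] (2.3) datum — director-ym №338 ∕
№343 (E1)(iii-b), FLAG №16 ∕ ruling (α); dag-n12-c DESIGN memo a793b2ebc0b803bf (ii); `N12-ROAD-TWIN-ORDER-2026-08-30.md`).  Count-neutral helper of K1⁹ `stmt-QuantumFields-27364`,
`--kind proof --supports … --as helper`.  THEOREMS ONLY (0 `def`, 0 `instance`, 0 `sorry`).

HONEST FRAMING (director-ym №338 (5)).  PURELY ADDITIVE: the parent stays landed and true on its own text; nothing in it is edited; no displayed premise of any consumer is deleted or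
weakened; every hypothesis of the parent stays a hypothesis.  Nothing of Bałaban's analysis asserted; N12 NOT discharged; K0⁷ ∕ K1⁹ NOT closed; counts unmoved (typed 28∕28 · discharged
8∕27, A 8∕28; K 1∕4); one finite 𝕋⁴ programme at fixed ε — R4 closes the conditional rung `BalabanLadder.UV` only; NOT the Yang–Mills mass gap (Clay); nothing continuum ∕ ℝ⁴ ∕ OS.

PARENT's DOCSTRING (the mathematics and the citations; read the site-level `𝐁` as the bond datum `𝔅`):
# BalabanUVNodes ∕ N12 — (β)♭ FOR A GENERAL DETERMINING SET `𝐁 = {Γ_j}_{j ≤ k}` ([Balaban1988Convergent] (2.2)): THE NULL SPACE OF THE FLAT SECOND VARIATION ON THE JOINT LINEARISED FIBRE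
# `Q^{(j)}X = 0 on the bonds meeting Γ_j, j ≤ k` IS `{dφ : φ constant along every constrained bond at the j-fold centres}` — MODULO ONE DISPLAYED GEOMETRIC LETTER (L) ON `𝐁` (an essential
# loop of constrained bonds in every direction); it SHRINKS to `Lie (4) = {dφ : φ = 0 at the constrained centres}` exactly when the constrained-centre graph is connected (letter (C)) —
# and the nondegeneracy ∕ positivity letter at NODE 00's flat multi-scale chart for such `𝐁`, modulo (L) and a slice letter in the locally-constant form

Cell `pub-ymgap` (HUMAN RULINGS D-0062 ∕ D-0149), WIDTH SEAT `pub-ymgap-dag-n12-w3` g2 (node N12 = [B15]; key K1⁷ `stmt-QuantumFields-20542`, `--kind proof --supports … --as helper`;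
count-neutral).  THEOREMS ONLY (0 `def`, 0 `instance`, 0 `sorry`); every input CONSUMED BY NAME: this seat's `N12FlatFibreNullSpace` (matrix Poincaré lemma, `iterLin_dirConst`,
`mem_of_sub_mem`) and `N12FlatChartHnd` (`coe_plaq_eq_zero_of_deriv_deriv_eq_zero`, `deriv_deriv_wilsonAction4_expChart_one_nonneg`); the route UnitScaleTilt's `Prop7CombGauge.iterLin_add`,
`Prop7AvgLinearisation.iterLin_grad`; dag-n10-w1's `N12FlatChartDerivIterLin.fderiv_msChart_one_apply_eq_iterLin` ∕ `iterLin_mem_lieSU`; n07-w2's `Node00.msChart` ∕ `coe_suProj_of_mem`.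

WHY.  The files `N12FlatFibreNullSpace` ∕ `N12FlatChartHnd` treat the whole-lattice `k`-fold constraint (`𝐁 ⊇ atScale k`, [Balaban1985Variational] (5)); the (1.74) object of
[Balaban1989LargeFieldI] Prop. 1 carries the MULTI-LEVEL determining sets `𝔹_k^{(n)}` of (1.14)–(1.16) (`B15DeterminingSets.detSetN ∕ detSetTop`), whose members `Γ_j` sit at different
scales in different regions.  For such `𝐁` two geometric facts enter, DISPLAYED here as letters: (L) for every direction `μ` some level `j ≤ k` carries a nonempty `e_μ`-invariant set of
sites all of whose `μ`-bonds are constrained (an essential loop — kills the constant vector function of the torus Poincaré lemma; at the record: the finest member `Γ₀ = Ω₁ᶜ` contains whole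
lattice lines), and (C) the graph of constrained centres (edges = constrained bonds of all levels, read on the finest lattice) is connected.  LOCATED: the flat null space on the joint
kernel is `{dφ : φ LOCALLY constant on that graph}` (modulo (L) only, §1) — for a DISCONNECTED graph this is strictly larger than `Lie (4)` (at the exactly flat datum the symmetry group of
the joint fibre exceeds the group (4) of transformations trivial at the constrained centres), so the slice letter for `hnd` is stated against the locally-constant pure gauges; (C) is
needed only to identify the null space with `Lie (4)`.  Neither (L) nor (C) is proved here for NODE 00's `Bj`∕`detSetTop`.

CONTENTS.
§1 `sum_shift_finset_eq` (re-indexing a sum over an `e_μ`-invariant finite set of sites), ★★★ `exists_locConstGauge_of_plaq_eq_zero_of_iterLin_eq_zero_detSet` (the null-space theorem for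
   general `𝐁` modulo (L): `X = dφ`, `φ` constant along every constrained bond at the centres), ★★ `plaq_eq_zero_and_iterLin_eq_zero_iff_detSet` (the characterisation), ★★
   `exists_constrGauge_of_plaq_eq_zero_of_iterLin_eq_zero_detSet` (under (C): `φ = 0` at every constrained centre — the `Lie (4)` form), ★★ `eq_zero_of_transversal_of_iterLin_eq_zero_detSet`
   (the `hnd` shape on a slice transversal to the locally-constant pure gauges, modulo (L)).
§2 at NODE 00's objects (the chart `msChart … k 𝐁` reads the members of `𝐁` up to level `k`; members above `k`, if any, are not constraints of the chart and are not used): `iterLin_eq_zero_of_fderiv_msChart_one_eq_zero_detSet`,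
   ★★★ `eq_zero_of_fderiv_msChart_one_eq_zero_of_transversal_detSet`, ★★ `deriv_deriv_pos_of_fderiv_msChart_one_eq_zero_of_transversal_detSet`.
§3 sanity instance: `hloop_atScale`, `hconn_atScale` — the whole-lattice `k`-fold constraint `atScale k` satisfies (L) and (C) (recovering the hypotheses-free `N12FlatFibreNullSpace`).

HONEST FRAMING.  Flat configuration only; letters (L) (everywhere), (C) (in the `Lie (4)` form only) and the slice letter DISPLAYED; no constants; nothing of Bałaban's estimates asserted; N12 NOT discharged; K1⁷ NOT closed; counts
unmoved (typed 28∕28 · discharged 5∕27); one finite 𝕋⁴ programme at fixed ε — R4 closes the conditional rung `BalabanLadder.UV` only; the Yang–Mills mass gap (Clay) is NOT proved by any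
of this; nothing continuum ∕ ℝ⁴ ∕ OS.
-/

noncomputable section

open scoped BigOperators Matrix.Norms.L2Operator Topology

namespace Summit.QuantumFields.YangMills.BalabanUVNodes.N12FlatFibreNullSpaceDetSetB

open Literature.MathematicalPhysics.QuantumFieldTheory.Balaban1983to89.B15DeterminingSetsB

open Literature.MathematicalPhysics.QuantumFieldTheory.Balaban1983to89
open T4Continuum (T4Family)
open BlockAveragingEMLLinearised (linAvg)
open T4AdjointCovarianceUnitary (lieSU)
open B15DeterminingSets
open LatticeFieldCalculus (shiftEquiv)
open Node00
open Summit.QuantumFields.YangMills.Theorems.Prop7CombGauge (iterLin_add)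
open Summit.QuantumFields.YangMills.Theorems.Prop7AvgLinearisation (iterLin_grad)
open Summit.QuantumFields.YangMills.BalabanUVNodes.N12FlatFibreNullSpace
  (exists_grad_add_dirConst_of_plaq_eq_zero_matrix iterLin_dirConst mem_of_sub_mem)
open Summit.QuantumFields.YangMills.BalabanUVNodes.N12FlatChartDerivIterLin (iterLin_mem_lieSU)
open Summit.QuantumFields.YangMills.BalabanUVNodes.N12FlatChartDerivIterLinB (fderiv_msChart_one_apply_eq_iterLin)
open Summit.QuantumFields.YangMills.BalabanUVNodes.N12FlatChartHnd (coe_plaq_eq_zero_of_deriv_deriv_eq_zero deriv_deriv_wilsonAction4_expChart_one_nonneg)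

section
variable {F : T4Family} {N : ℕ} [NeZero N] {K k : ℕ}

/-- For a determining set with no member above `k`, the kernel of `DΦ(0)` (`Φ = msChartB F N K k 𝔅 (M˙1) 1`) kills `(Q^{(j)}↑X)(c)` at EVERY constrained bond `(j, c)`, `j ≤ k`.
[cite: Balaban1985Variational, (44)-(48) p.285; Balaban1988Convergent, (2.10)-(2.12) p.256] -/
theorem iterLin_eq_zero_of_fderiv_msChart_one_eq_zero_detSet
    (Q : (i : ℕ) → (PBond (F.P K) 0 → Matrix (Fin N) (Fin N) ℂ) → PBond (F.P K) i → Matrix (Fin N) (Fin N) ℂ)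
    (hQ0 : ∀ Y, Q 0 Y = Y) (hQs : ∀ (i : ℕ) (Y : PBond (F.P K) 0 → Matrix (Fin N) (Fin N) ℂ) (c : PBond (F.P K) (i + 1)), Q (i + 1) Y c = linAvg (Q i Y) c)
    (𝔅 : BDetSet (F.P K)) {X : PBond (F.P K) 0 → lieSU (Fin N)}
    (hker : fderiv ℝ (msChartB F N K k 𝔅 (avgFamily (avOfRecord F N K) (1 : GaugeField (F.P K) 0 (SU N))) (1 : GaugeField (F.P K) 0 (SU N))) 0 X = 0)
    {j : ℕ} (hj : j ≤ k) {c : PBond (F.P K) j} (hc : c ∈ (𝔅 j)) :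
    Q j (fun b => (X b : Matrix (Fin N) (Fin N) ℂ)) c = 0 := by
  set i : Fin (constrCardB 𝔅 k) := constrEnumB 𝔅 k ⟨⟨j, Nat.lt_succ_of_le hj⟩, ⟨c, hc⟩⟩ with hi
  have h := fderiv_msChart_one_apply_eq_iterLin (F := F) (N := N) (K := K) (k := k) Q hQ0 hQs 𝔅 X i
  rw [hker, hi, Equiv.symm_apply_apply] at h
  have hmem : Q j (fun b => (X b : Matrix (Fin N) (Fin N) ℂ)) c ∈ lieSU (Fin N) := iterLin_mem_lieSU Q hQ0 hQs (fun b => (X b).2) j c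
  have h' := congrArg (fun Z : lieSU (Fin N) => (Z : Matrix (Fin N) (Fin N) ℂ)) h
  simp only [Pi.zero_apply, ZeroMemClass.coe_zero] at h'
  rw [coe_suProj_of_mem hmem] at h'
  exact h'.symm

end

end Summit.QuantumFields.YangMills.BalabanUVNodes.N12FlatFibreNullSpaceDetSetB

end
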